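import Summits.Ventures.PercRepro.ProfileTwoCosimple
import Summits.Ventures.PercRepro.ProfileTwoAverage
import Summits.Ventures.PercRepro.C025ProfileRowReduction

/-!
# PercRepro — THE ROW `q = 2` OF THE PROFILE INEQUALITY FOR EVERY FINITE MATROID (self-contained)
(p10, gen 4; S5 §2.5 of `proofs/SUBCLAIM-S5-p10.md`; one-pager `proofs/P10-AVGSTEP.md`)

SELF-CONTAINED VARIANT of `ProfileTwoRow` (the farm has no olean for `ProfileTwoSimpleBridge`, landed 09:2xZ, since
the builder skipped its window — OPS-49): the four theorems of ProfileTwoSimpleBridge (commit 9993ed1df84a) are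
re-stated here VERBATIM under primed names (`mul_ineq'`, `choose_le_choose_two_mul_choose'`,
`fat_demand_le_choose_mul_card_depU'`, `profileIneq_two_of_indep'`) — Theorem B on every simple matroid and the bridge
`INDEP_{2,u} → (Π_{2,u})` — so that the row can be assembled on the oleans that exist (ProfileTwoCosimple,
ProfileTwoAverage p400288, C025ProfileRowReduction).

* `profileIneq_two_of_simple` — `(Π_{2,u})` on every simple matroid, every `u ≥ 2` (the bridge ∘ `indep2_of_simple`);
* **`profileIneq_two_all`** — `(Π_{2,u})` for EVERY finite matroid and every `u > 2`, by night-3's single-row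
  reduction `profileIneq_row_of_simple` (the row `(2,u)` on simple matroids with the row `(1,u−1)` on every matroid,
  `profileIneq_one_all`, gives the row `(2,u)` on every matroid);
* `profileIneq_le_two_all` — every row `q ≤ 2` of C-032 (with `profileIneq_zero`, `profileIneq_one_all`).
-/

open scoped Matroid

namespace PercRepro.Cogirth

open Finset ThmH Skew Shadow Profile

variable {α : Type} [DecidableEq α] {M : Matroid α} [M.Finite]

/-! ### ProfileTwoSimpleBridge, re-stated under primed names (byte-identical proofs) -/


/-! ### The binomial inequality -/

/-- `a(a+1)(b+1)(b+2) ≥ 2(a+b)(a+b+1)` for `a ≥ 1`, `b ≥ 0` (equality at `a = 1`). -/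
theorem mul_ineq' (a b : ℕ) (ha : 1 ≤ a) :
    2 * (a + b) * (a + b + 1) ≤ a * (a + 1) * (b + 1) * (b + 2) := by
  rcases Nat.lt_or_ge a 2 with h | h
  · have ha1 : a = 1 := by omega
    subst ha1
    exact Nat.le_of_eq (by ring)
  · have h1 : 2 * (a + b) ≤ a * (b + 2) := by nlinarith
    have h2 : a + b + 1 ≤ (a + 1) * (b + 1) := by nlinarith
    calc 2 * (a + b) * (a + b + 1) ≤ (a * (b + 2)) * ((a + 1) * (b + 1)) := Nat.mul_le_mul h1 h2
      _ = a * (a + 1) * (b + 1) * (b + 2) := by ring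

/-- `C(R, u−2) ≤ C(u,2) · C(R−2, u−2)` for `2 ≤ u ≤ R`. -/
theorem choose_le_choose_two_mul_choose' {u R : ℕ} (hu : 2 ≤ u) (huR : u ≤ R) :
    R.choose (u - 2) ≤ u.choose 2 * (R - 2).choose (u - 2) := by
  obtain ⟨k, rfl⟩ : ∃ k, u = k + 2 := ⟨u - 2, by omega⟩
  obtain ⟨b, rfl⟩ : ∃ b, R = k + 2 + b := ⟨R - (k + 2), by omega⟩
  rw [show k + 2 - 2 = k by omega, show k + 2 + b - 2 = k + b by omega]
  have e1 := Nat.choose_succ_right_eq (k + 2 + b) k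
  rw [show k + 2 + b - k = b + 2 by omega] at e1
  have e2 := Nat.choose_succ_right_eq (k + 2 + b) (k + 1)
  rw [show k + 2 + b - (k + 1) = b + 1 by omega] at e2
  have e3 := Nat.choose_mul (n := k + 2 + b) (k := k + 2) (s := 2) (by omega)
  rw [show k + 2 + b - 2 = k + b by omega, show k + 2 - 2 = k by omega] at e3
  have two_dvd_1 : 2 ∣ (k + 2) * (k + 1) := by
    rw [Nat.mul_comm]
    exact (Nat.even_mul_succ_self (k + 1)).two_dvd
  have two_dvd_2 : 2 ∣ (k + 2 + b) * (k + 1 + b) := by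
    rw [show (k + 2 + b) * (k + 1 + b) = (k + 1 + b) * ((k + 1 + b) + 1) by ring]
    exact (Nat.even_mul_succ_self (k + 1 + b)).two_dvd
  have hk2 : (k + 2).choose 2 * 2 = (k + 2) * (k + 1) := by
    rw [Nat.choose_two_right, show k + 2 - 1 = k + 1 by omega]
    exact Nat.div_mul_cancel two_dvd_1
  have hb2 : (k + 2 + b).choose 2 * 2 = (k + 2 + b) * (k + 1 + b) := by
    rw [Nat.choose_two_right, show k + 2 + b - 1 = k + 1 + b by omega]
    exact Nat.div_mul_cancel two_dvd_2
  have hA : (k + 2 + b).choose k * ((b + 2) * (b + 1)) =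
      2 * ((k + 2 + b).choose 2 * (k + b).choose k) := by
    calc (k + 2 + b).choose k * ((b + 2) * (b + 1))
        = ((k + 2 + b).choose k * (b + 2)) * (b + 1) := by ring
      _ = ((k + 2 + b).choose (k + 1) * (k + 1)) * (b + 1) := by rw [e1]
      _ = ((k + 2 + b).choose (k + 1) * (b + 1)) * (k + 1) := by ring
      _ = ((k + 2 + b).choose (k + 2) * (k + 2)) * (k + 1) := by rw [e2]
      _ = (k + 2 + b).choose (k + 2) * ((k + 2) * (k + 1)) := by ring
      _ = (k + 2 + b).choose (k + 2) * ((k + 2).choose 2 * 2) := by rw [hk2]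
      _ = 2 * ((k + 2 + b).choose (k + 2) * (k + 2).choose 2) := by ring
      _ = 2 * ((k + 2 + b).choose 2 * (k + b).choose k) := by rw [e3]
  have hineq := mul_ineq' (k + 1) b (by omega)
  refine Nat.le_of_mul_le_mul_right (c := (b + 2) * (b + 1) * 2) ?_ (by positivity)
  calc (k + 2 + b).choose k * ((b + 2) * (b + 1) * 2)
      = ((k + 2 + b).choose k * ((b + 2) * (b + 1))) * 2 := by ring
    _ = 2 * ((k + 2 + b).choose 2 * (k + b).choose k) * 2 := by rw [hA]
    _ = 2 * ((k + 2 + b).choose 2 * 2) * (k + b).choose k := by ring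
    _ = 2 * ((k + 2 + b) * (k + 1 + b)) * (k + b).choose k := by rw [hb2]
    _ = (2 * (k + 1 + b) * (k + 1 + b + 1)) * (k + b).choose k := by ring
    _ ≤ ((k + 1) * (k + 1 + 1) * (b + 1) * (b + 2)) * (k + b).choose k :=
        Nat.mul_le_mul_right _ hineq
    _ = (k + b).choose k * ((b + 2) * (b + 1)) * ((k + 2) * (k + 1)) := by ring
    _ = (k + b).choose k * ((b + 2) * (b + 1)) * ((k + 2).choose 2 * 2) := by rw [hk2]
    _ = (k + 2).choose 2 * (k + b).choose k * ((b + 2) * (b + 1) * 2) := by ring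

/-! ### Theorem B on every simple matroid, and the bridge -/

/-- **Theorem B (every simple matroid)**: `Σ_{B fat} demand(B) ≤ C(u,2) · #depU` for `2 ≤ u ≤ ρ(E)`. -/
theorem fat_demand_le_choose_mul_card_depU' (hs : Simple' M) {u : ℕ} (hu : 2 ≤ u) (huR : u ≤ rk M (gr M)) :
    ∑ B ∈ fat2 M, demand M 2 u B ≤ u.choose 2 * (depU M u).card := by
  have hterm : ∀ B ∈ fat2 M, demand M 2 u B ≤ u.choose 2 * (indepSets (M ／ (B : Set α)) (u - 2)).card := by
    intro B hB
    have hBg : B ⊆ gr M := (mem_Rq.1 (mem_fat2.1 hB).1).1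
    have hrkB : rk M B = 2 := rk_eq_of_mem_Rq (mem_fat2.1 hB).1
    have hrk := rk_gr_contract_add_rk hBg
    rw [hrkB] at hrk
    -- `C(ρ(E) − 2, u − 2) ≤ I_{u−2}(M / B)` (the subsets of a basis)
    have hA := choose_rk_le_card_indepSets (M := M ／ (B : Set α)) (u - 2)
    have hrk' : rk (M ／ (B : Set α)) (gr (M ／ (B : Set α))) = rk M (gr M) - 2 := by omega
    rw [hrk'] at hA
    have hdem : demand M 2 u B ≤ (rk M (gr M)).choose (u - 2) := by
      unfold demand
      split_ifs with h
      · apply Nat.choose_le_choose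
        exact rk_mono' (M := M) (sdiff_subset : gr M \ B ⊆ gr M)
      · exact Nat.zero_le _
    calc demand M 2 u B ≤ (rk M (gr M)).choose (u - 2) := hdem
      _ ≤ u.choose 2 * (rk M (gr M) - 2).choose (u - 2) := choose_le_choose_two_mul_choose' hu huR
      _ ≤ u.choose 2 * (indepSets (M ／ (B : Set α)) (u - 2)).card := Nat.mul_le_mul_left _ hA
  calc ∑ B ∈ fat2 M, demand M 2 u B
      ≤ ∑ B ∈ fat2 M, u.choose 2 * (indepSets (M ／ (B : Set α)) (u - 2)).card := sum_le_sum hterm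
    _ = u.choose 2 * ∑ B ∈ fat2 M, (indepSets (M ／ (B : Set α)) (u - 2)).card := by rw [mul_sum]
    _ = u.choose 2 * (fatPairs M u).card := by rw [card_fatPairs u]
    _ ≤ u.choose 2 * (depU M u).card := Nat.mul_le_mul_left _ (card_fatPairs_le_card_depU hs hu)

/-- **THE BRIDGE**: on every simple matroid, the independent half `INDEP_{2,u}` implies `(Π_{2,u})`. -/
theorem profileIneq_two_of_indep' (hs : Simple' M) (u : ℕ) (hu : 2 ≤ u)
    (hI : u ≤ rk M (gr M) → ∑ B ∈ indepSets M 2, demand M 2 u B ≤ u.choose 2 * (indepSets M u).card) :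
    ProfileIneq M 2 u := by
  unfold ProfileIneq
  rcases Nat.lt_or_ge (rk M (gr M)) u with hlt | huR
  · have hzero : ∀ B ∈ Rq M 2, price M 2 u B = 0 := by
      intro B _
      unfold price
      rw [if_neg]
      intro h
      rw [← coe_rk] at h
      have h' : u ≤ rk M (gr M \ B) := by exact_mod_cast h
      have := rk_mono' (M := M) (sdiff_subset : gr M \ B ⊆ gr M)
      omega
    rw [sum_eq_zero hzero]
    exact Nat.cast_nonneg _
  have hpos : (0 : ℚ) < (u.choose 2 : ℚ) := by
    exact_mod_cast Nat.choose_pos hu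
  apply le_of_mul_le_mul_left _ hpos
  rw [mul_sum]
  simp_rw [choose_mul_price_eq_demand 2 u hu]
  rw [Rq_two_eq_union, sum_union disjoint_indepSets_fat2, levelSet_eq_union u,
    card_union_of_disjoint (disjoint_indepSets_depU u)]
  have h1 := hI huR
  have h2 := fat_demand_le_choose_mul_card_depU' hs hu huR
  have h4 : ∑ B ∈ indepSets M 2, demand M 2 u B + ∑ B ∈ fat2 M, demand M 2 u B ≤
      u.choose 2 * ((indepSets M u).card + (depU M u).card) := by
    rw [Nat.mul_add]
    exact Nat.add_le_add h1 h2
  exact_mod_cast h4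


/-! ### The row -/


/-- **The row `q = 2` of `(Π)` on every simple matroid**, every `u ≥ 2`. -/
theorem profileIneq_two_of_simple (hs : Simple' M) (u : ℕ) (hu : 2 ≤ u) : ProfileIneq M 2 u := by
  apply profileIneq_two_of_indep' hs u hu
  intro _
  rcases Nat.eq_or_lt_of_le hu with h | h
  · subst h
    exact indep2_two
  · exact indep2_of_simple hs h

omit [DecidableEq α] in
/-- Set-form simplicity (every `T ⊆ E` with `|T| ≤ 2` independent) gives `Simple'`. -/
theorem simple'_of_set (h : ∀ T ⊆ M.E, T.encard ≤ 2 → M.Indep T) : Simple' M := by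
  intro B hB hc
  apply h
  · rw [← coe_gr]
    exact_mod_cast hB
  · rw [Set.encard_coe_eq_coe_finsetCard]
    exact_mod_cast hc

/-- **THE ROW `q = 2` OF C-032 (Π) FOR EVERY FINITE MATROID**: for every finite matroid `M` and every `u > 2`,
`Σ_{B : ρ(B) = 2} price(B) ≤ #{S : ρ(S) = u}`. -/
theorem profileIneq_two_all (M : Matroid α) [M.Finite] (u : ℕ) (hu : 2 < u) : ProfileIneq M 2 u := by
  obtain ⟨u', rfl⟩ : ∃ u', u = u' + 1 := ⟨u - 1, by omega⟩
  exact profileIneq_row_of_simple (q := 1) (u := u') (by omega)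
    (fun N _ hN => profileIneq_two_of_simple (simple'_of_set hN) (u' + 1) (by omega))
    (fun N _ => profileIneq_one_all N u' (by omega)) M

/-- The rows `q ≤ 2` of C-032 (Π) for every finite matroid and every `u > q`. -/
theorem profileIneq_le_two_all (M : Matroid α) [M.Finite] (q u : ℕ) (hq : q ≤ 2) (hqu : q < u) :
    ProfileIneq M q u := by
  rcases Nat.lt_or_ge q 2 with hlt | hge
  · rcases Nat.lt_or_ge q 1 with h0 | h1
    · obtain rfl : q = 0 := by omega
      exact profileIneq_zero u
    · obtain rfl : q = 1 := by omega
      exact profileIneq_one_all M u (by omega)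
  · obtain rfl : q = 2 := by omega
    exact profileIneq_two_all M u hqu

end PercRepro.Cogirth
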